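import Mathlib
import Literature.NumberTheory.Transcendental.KZProduct
import Literature.NumberTheory.Transcendental.KZProductIdeal
import Literature.NumberTheory.Transcendental.KZCalculusProofs
import Literature.NumberTheory.Transcendental.KZDominatedFamilyRelations
import Literature.NumberTheory.Transcendental.KZVolumeConjectureProofs
import Literature.NumberTheory.Transcendental.SemialgebraicMapsProofs
import Summits.KontsevichZagierPeriods.KontsevichZagierPeriods.Theorems.SoloInformedPolyJacobian
import Summits.KontsevichZagierPeriods.KontsevichZagierPeriods.Theorems.SoloInformedVolumeLadder
import Summits.KontsevichZagierPeriods.KontsevichZagierPeriods.Theorems.SoloInformedDiscCancellation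
import Summits.KontsevichZagierPeriods.KontsevichZagierPeriods.Theorems.SoloInformedTorsionFree
import HarnessLib
import HarnessLib.Audit

/-!
# SoloInformed — cones in the Kontsevich–Zagier calculus

For a planar representation `K` of dimension `2` with compact domain and integrand `1` we prove,
inside the four-move calculus,

  `soloInformed_three_nsmul_coneRep_sub_mem_relations :  3 · [C K, 1] − [K, 1] ∈ relations`,

where `C K = {(t y₁, t y₂, t) | y ∈ K, t ∈ [0,1]} ⊂ ℝ³` is the cone with apex the origin over the
base `K × {1}` (so `vol(C K) = area(K)/3`, `soloInformed_value_coneRep`). The moves, all with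
`ℚ`-polynomial data: one Newton–Leibniz move along the last coordinate with primitive `t³`
(`[K × [0,1], 3t²] ∼ [K, 1]`); integrand additivity (`[K × [0,1], 3t²] ∼ 3 · [K × [0,1], t²]`);
removal of the null sets `{t = 0}` and the apex (rule (1a)); and rule (2) for the polynomial map
`Ψ(y₁, y₂, t) = (t y₁, t y₂, t)` with `det Ψ' = t²`, injective on `{t > 0}`.

Consequence for the volume ladder (`SoloInformedVolumeLadder`): **volume rung `3` holds for cones
over planar regions**, granted the Huber–Wüstholz theorem on curve periods (through volume rung
`2`, `soloInformed_volumeRung_le_two`) and using that the formal period ring is torsion-free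
(`SoloInformedTorsionFree`): two such cones with equal volume are KZ-equivalent
(`soloInformed_cone_equivalent_of_value_eq`). Together with `SoloInformedPappus` (solids of
revolution) this records the mechanism by which the calculus reaches dimension `3`: a
`ℚ`-algebraic fibration over a planar base with polynomial volume density reduces the solid to
dimension `2` by the product structure and one Newton–Leibniz move. The open content of volume
rung `3` lies in pairs of solids without such a common reduction (residency paper, Thm. II,
corrected instance: a solid torus against the box `{1 ≤ x ≤ 2, 1 ≤ y ≤ 3, 0 ≤ xyz ≤ 1}`).

Residency `solo-KontsevichZagierPeriods-informed` (PLAN.md, session s16).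
References: M. Kontsevich, D. Zagier, *Periods* (2001), §1.1–§1.2.
-/

noncomputable section

open MeasureTheory Set Filter
open scoped Topology

namespace Summit.KontsevichZagierPeriods.KontsevichZagierPeriods.Theorems

open Literature.NumberTheory.Transcendental Literature.NumberTheory.Transcendental.KZ
open Literature.ModelTheory.ExponentialFields (IsSemialgebraic isSemialgebraic_setOf_eval_le
  isSemialgebraic_setOf_eval_lt isSemialgebraic_setOf_eval_pos isSemialgebraic_setOf_eval_eq_zero)

/-! ### The weighted slabs `[K × [0,1], c · t²]` -/

/-- `[K × [0,1], c · t²]`: the unit slab over `K` (last coordinate `t`) weighted by `c t²`. -/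
def soloInformedConePow (K : IntegralRep 2) (hKc : IsCompact K.domain) (c : ℕ) : IntegralRep 3 where
  domain := K.slabDomain 0
  integrand z := (c : ℝ) * z (Fin.last 2) ^ 2
  isSemialgebraic_domain := K.isSemialgebraic_slabDomain 0
  isSemialgebraicFunOn_integrand := by
    have h := isSemialgebraicFunOn_aeval (K.isSemialgebraic_slabDomain 0)
      (MvPolynomial.C (c : ℚ) * MvPolynomial.X (Fin.last 2) ^ 2 : MvPolynomial (Fin 3) ℚ)
    simp only [map_mul, map_pow, MvPolynomial.aeval_X, map_natCast] at h
    exact h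
  integrableOn :=
    (continuous_const.mul ((continuous_apply (Fin.last 2)).pow 2)).continuousOn.integrableOn_compact
      (SoloInformed.isCompact_slabDomain K 0 hKc)

/-- Domain of the weighted slab. -/
@[simp] theorem soloInformedConePow_domain (K : IntegralRep 2) (hKc : IsCompact K.domain) (c : ℕ) :
    (soloInformedConePow K hKc c).domain = K.slabDomain 0 := rfl

/-- Integrand of the weighted slab. -/
@[simp] theorem soloInformedConePow_integrand (K : IntegralRep 2) (hKc : IsCompact K.domain)
    (c : ℕ) : (soloInformedConePow K hKc c).integrand = fun z => (c : ℝ) * z (Fin.last 2) ^ 2 := rfl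

/-- Membership in the unit slab over `K`. -/
theorem soloInformed_mem_slabDomain (K : IntegralRep 2) (z : Fin 3 → ℝ) :
    z ∈ K.slabDomain 0 ↔ Fin.init z ∈ K.domain ∧ 0 ≤ z (Fin.last 2) ∧ z (Fin.last 2) ≤ 1 := by
  simp [IntegralRep.slabDomain]

/-- **Newton–Leibniz.** `[K × [0,1], 3t²] − [K, 1] ∈ relations` when `K` has integrand `1`:
primitive `F = t³`, `F(y,1) − F(y,0) = 1`. -/
theorem soloInformed_conePow_three_sub_mem_relations (K : IntegralRep 2) (hKc : IsCompact K.domain)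
    (hK1 : ∀ y ∈ K.domain, K.integrand y = 1) :
    of (soloInformedConePow K hKc 3) - of K ∈ relations := by
  refine newtonLeibnizRel_subset_relations ⟨2, soloInformedConePow K hKc 3, K,
    fun _ => ((0 : ℕ) : ℝ), fun _ => ((0 : ℕ) : ℝ) + 1, fun z => z (Fin.last 2) ^ 3, ?_,
    isSemialgebraicFunOn_natCast K.isSemialgebraic_domain 0, ?_, fun _ _ => by simp, rfl,
    ?_, ?_, ?_, rfl⟩
  · exact (isSemialgebraicFunOn_aeval (K.isSemialgebraic_slabDomain 0)
      (MvPolynomial.X (Fin.last 2) ^ 3 : MvPolynomial (Fin 3) ℚ)).congr fun z _ => by simp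
  · exact (isSemialgebraicFunOn_aeval K.isSemialgebraic_domain
      (((0 : ℕ) : MvPolynomial (Fin 2) ℚ) + 1)).congr fun x _ => by simp
  · intro x _
    simp only [Fin.snoc_last]
    fun_prop
  · intro x _ t _
    show HasDerivAt (fun s : ℝ => (Fin.snoc x s : Fin 3 → ℝ) (Fin.last 2) ^ 3)
      (((3 : ℕ) : ℝ) * (Fin.snoc x t : Fin 3 → ℝ) (Fin.last 2) ^ 2) t
    simp only [Fin.snoc_last]
    simpa using hasDerivAt_pow 3 t
  · intro x hx
    simp only [Fin.snoc_last]
    rw [hK1 x hx]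
    norm_num

/-- **Integrand additivity.** `[K × [0,1], (a+b)t²] − [K × [0,1], a t²] − [K × [0,1], b t²] ∈
relations`. -/
theorem soloInformed_conePow_add_sub_mem_relations (K : IntegralRep 2) (hKc : IsCompact K.domain)
    (a b : ℕ) :
    of (soloInformedConePow K hKc (a + b)) - of (soloInformedConePow K hKc a) -
      of (soloInformedConePow K hKc b) ∈ relations :=
  integrandAddRel_subset_relations ⟨3, soloInformedConePow K hKc (a + b), soloInformedConePow K hKc a,
    soloInformedConePow K hKc b, rfl, rfl, fun z _ => by simp [add_mul], rfl⟩

/-! ### The cone map `Ψ(y₁, y₂, t) = (t y₁, t y₂, t)` -/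

/-- The components of `Ψ` as polynomials. -/
def soloInformedConePoly : Fin 3 → MvPolynomial (Fin 3) ℚ :=
  ![MvPolynomial.X 0 * MvPolynomial.X 2, MvPolynomial.X 1 * MvPolynomial.X 2, MvPolynomial.X 2]

/-- The cone map `Ψ(y₁, y₂, t) = (t y₁, t y₂, t)`. -/
def soloInformedConeMap : (Fin 3 → ℝ) → (Fin 3 → ℝ) := soloInformedPolyMap soloInformedConePoly

/-- First component of `Ψ`. -/
@[simp] theorem soloInformedConeMap_apply_zero (u : Fin 3 → ℝ) :
    soloInformedConeMap u 0 = u 0 * u 2 := by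
  simp [soloInformedConeMap, soloInformedConePoly]

/-- Second component of `Ψ`. -/
@[simp] theorem soloInformedConeMap_apply_one (u : Fin 3 → ℝ) :
    soloInformedConeMap u 1 = u 1 * u 2 := by
  simp [soloInformedConeMap, soloInformedConePoly]

/-- Third component of `Ψ`. -/
@[simp] theorem soloInformedConeMap_apply_two (u : Fin 3 → ℝ) : soloInformedConeMap u 2 = u 2 := by
  simp [soloInformedConeMap, soloInformedConePoly]

/-- `Ψ` is continuous. -/
theorem soloInformed_continuous_coneMap : Continuous soloInformedConeMap :=
  continuous_iff_continuousAt.2 fun u =>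
    (soloInformed_hasFDerivAt_polyMap soloInformedConePoly u).continuousAt

/-- Jacobian determinant of `Ψ`: `det Ψ'(y, t) = t²`. -/
theorem soloInformed_det_coneMap (u : Fin 3 → ℝ) :
    (soloInformedJacCLM soloInformedConePoly u).det = u 2 ^ 2 := by
  rw [soloInformed_det_jacCLM, Matrix.det_fin_three]
  simp [soloInformedJacMat_apply, soloInformedConePoly, sq]

/-! ### The cone and its representation -/

/-- The cone `C K = Ψ(K × [0,1]) = {(t y₁, t y₂, t) | y ∈ K, 0 ≤ t ≤ 1}`. -/
def soloInformedCone (K : IntegralRep 2) : Set (Fin 3 → ℝ) := soloInformedConeMap '' K.slabDomain 0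

/-- The cone is `ℚ`-semialgebraic (Tarski–Seidenberg). -/
theorem isSemialgebraic_soloInformedCone (K : IntegralRep 2) : IsSemialgebraic ℚ (soloInformedCone K) :=
  IsSemialgebraicMapOn.isSemialgebraic_image_holds
    (isSemialgebraicMapOn_aeval (K.isSemialgebraic_slabDomain 0) soloInformedConePoly) Subset.rfl
    (K.isSemialgebraic_slabDomain 0)

/-- The cone over a compact base is compact. -/
theorem isCompact_soloInformedCone (K : IntegralRep 2) (hKc : IsCompact K.domain) :
    IsCompact (soloInformedCone K) :=
  (SoloInformed.isCompact_slabDomain K 0 hKc).image soloInformed_continuous_coneMap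

/-- **The cone** `[C K, 1]` as an integral representation of dimension `3`. -/
def soloInformedConeRep (K : IntegralRep 2) (hKc : IsCompact K.domain) : IntegralRep 3 where
  domain := soloInformedCone K
  integrand _ := 1
  isSemialgebraic_domain := isSemialgebraic_soloInformedCone K
  isSemialgebraicFunOn_integrand := by
    simpa using isSemialgebraicFunOn_ratCast (isSemialgebraic_soloInformedCone K) 1
  integrableOn := continuous_const.continuousOn.integrableOn_compact (isCompact_soloInformedCone K hKc)

/-- Domain of the cone representation. -/
@[simp] theorem soloInformedConeRep_domain (K : IntegralRep 2) (hKc : IsCompact K.domain) :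
    (soloInformedConeRep K hKc).domain = soloInformedCone K := rfl

/-- Integrand of the cone representation. -/
@[simp] theorem soloInformedConeRep_integrand (K : IntegralRep 2) (hKc : IsCompact K.domain) :
    (soloInformedConeRep K hKc).integrand = fun _ => 1 := rfl

/-- The cone representation is a volume representation of a compact solid. -/
theorem soloInformed_coneRep_isCompact_and_one (K : IntegralRep 2) (hKc : IsCompact K.domain) :
    IsCompact (soloInformedConeRep K hKc).domain ∧
      ∀ x ∈ (soloInformedConeRep K hKc).domain, (soloInformedConeRep K hKc).integrand x = 1 :=
  ⟨isCompact_soloInformedCone K hKc, fun _ _ => rfl⟩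

/-! ### Rule (2) for `Ψ` off the null sets `{t = 0}` and the apex -/

/-- The part `{t > 0}` of the slab, where `Ψ` is injective. -/
def soloInformedConeSrc (K : IntegralRep 2) : Set (Fin 3 → ℝ) :=
  K.slabDomain 0 ∩ {z | 0 < z (Fin.last 2)}

/-- The source is `ℚ`-semialgebraic. -/
theorem isSemialgebraic_soloInformedConeSrc (K : IntegralRep 2) :
    IsSemialgebraic ℚ (soloInformedConeSrc K) := by
  have h1 := isSemialgebraic_setOf_eval_lt (k := ℚ) (R := ℝ) (0 : MvPolynomial (Fin 3) ℚ)
    (MvPolynomial.X (Fin.last 2))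
  simp only [map_zero, MvPolynomial.aeval_X] at h1
  exact (K.isSemialgebraic_slabDomain 0).inter h1

/-- The source lies in the slab. -/
theorem soloInformedConeSrc_subset (K : IntegralRep 2) : soloInformedConeSrc K ⊆ K.slabDomain 0 :=
  inter_subset_left

/-- The source representation `[(K × (0,1]), t²]`. -/
def soloInformedConeSrcRep (K : IntegralRep 2) (hKc : IsCompact K.domain) : IntegralRep 3 :=
  (soloInformedConePow K hKc 1).restrict (soloInformedConeSrc K) (isSemialgebraic_soloInformedConeSrc K)
    (soloInformedConeSrc_subset K)

/-- The image `Ψ(source)` is `ℚ`-semialgebraic. -/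
theorem isSemialgebraic_soloInformedConeMap_image_src (K : IntegralRep 2) :
    IsSemialgebraic ℚ (soloInformedConeMap '' soloInformedConeSrc K) :=
  IsSemialgebraicMapOn.isSemialgebraic_image_holds
    (isSemialgebraicMapOn_aeval (isSemialgebraic_soloInformedConeSrc K) soloInformedConePoly)
    Subset.rfl (isSemialgebraic_soloInformedConeSrc K)

/-- `Ψ(source) ⊆ C K`. -/
theorem soloInformedConeMap_image_src_subset (K : IntegralRep 2) :
    soloInformedConeMap '' soloInformedConeSrc K ⊆ soloInformedCone K :=
  image_mono (soloInformedConeSrc_subset K)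

/-- The target representation `[Ψ(source), 1]` (a restriction of the cone representation). -/
def soloInformedConeTgtRep (K : IntegralRep 2) (hKc : IsCompact K.domain) : IntegralRep 3 :=
  (soloInformedConeRep K hKc).restrict (soloInformedConeMap '' soloInformedConeSrc K)
    (isSemialgebraic_soloInformedConeMap_image_src K) (soloInformedConeMap_image_src_subset K)

/-- **Rule (2) for `Ψ`.** `[source, t²] − [Ψ(source), 1] ∈ relations`. -/
theorem soloInformed_coneSrcRep_sub_tgtRep_mem_relations (K : IntegralRep 2)
    (hKc : IsCompact K.domain) :
    of (soloInformedConeSrcRep K hKc) - of (soloInformedConeTgtRep K hKc) ∈ relations := by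
  refine changeOfVariablesRel_subset_relations ⟨3, soloInformedConeSrcRep K hKc,
    soloInformedConeTgtRep K hKc, soloInformedConeMap, soloInformedJacCLM soloInformedConePoly,
    isSemialgebraicMapOn_aeval (isSemialgebraic_soloInformedConeSrc K) soloInformedConePoly,
    fun u _ => (soloInformed_hasFDerivAt_polyMap soloInformedConePoly u).hasFDerivWithinAt,
    ?_, rfl, fun u hu => ?_, rfl⟩
  · intro u hu v hv huv
    have hv2 : 0 < v 2 := hv.2
    have e2 : u 2 = v 2 := by simpa only [soloInformedConeMap_apply_two] using congr_fun huv 2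
    have e0 : u 0 * u 2 = v 0 * v 2 := by
      simpa only [soloInformedConeMap_apply_zero] using congr_fun huv 0
    have e1 : u 1 * u 2 = v 1 * v 2 := by
      simpa only [soloInformedConeMap_apply_one] using congr_fun huv 1
    rw [e2] at e0 e1
    ext j
    fin_cases j
    · exact mul_right_cancel₀ hv2.ne' e0
    · exact mul_right_cancel₀ hv2.ne' e1
    · exact e2
  · show ((1 : ℕ) : ℝ) * u (Fin.last 2) ^ 2 =
      1 * |(soloInformedJacCLM soloInformedConePoly u).det|
    rw [soloInformed_det_coneMap, abs_of_nonneg (sq_nonneg _), Nat.cast_one]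
    rfl

/-- `[K × [0,1], t²] − [source, t²] ∈ relations`: the difference of the domains lies in the plane
`t = 0`. -/
theorem soloInformed_conePow_one_sub_srcRep_mem_relations (K : IntegralRep 2)
    (hKc : IsCompact K.domain) :
    of (soloInformedConePow K hKc 1) - of (soloInformedConeSrcRep K hKc) ∈ relations := by
  refine (soloInformedConePow K hKc 1).of_sub_of_restrict_mem_relations
    (isSemialgebraic_soloInformedConeSrc K) (soloInformedConeSrc_subset K) ?_
  have hax : volume {u : Fin 3 → ℝ | u (Fin.last 2) = 0} = 0 := by
    rw [volume_pi]; exact Measure.pi_hyperplane _ _ _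
  refine measure_mono_null (fun x hx => ?_) hax
  rcases hx with ⟨hxP, hns⟩
  have hxP' : x ∈ K.slabDomain 0 := hxP
  rw [soloInformed_mem_slabDomain] at hxP'
  by_contra hc
  exact hns ⟨hxP, lt_of_le_of_ne hxP'.2.1 (Ne.symm hc)⟩

/-- `[C K, 1] − [Ψ(source), 1] ∈ relations`: the difference of the domains is the apex. -/
theorem soloInformed_coneRep_sub_tgtRep_mem_relations (K : IntegralRep 2)
    (hKc : IsCompact K.domain) :
    of (soloInformedConeRep K hKc) - of (soloInformedConeTgtRep K hKc) ∈ relations := by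
  refine (soloInformedConeRep K hKc).of_sub_of_restrict_mem_relations
    (isSemialgebraic_soloInformedConeMap_image_src K) (soloInformedConeMap_image_src_subset K) ?_
  have hsub : (soloInformedConeRep K hKc).domain \ soloInformedConeMap '' soloInformedConeSrc K ⊆
      {(0 : Fin 3 → ℝ)} := by
    rintro x ⟨⟨z, hz, rfl⟩, hx⟩
    have hz' := (soloInformed_mem_slabDomain K z).1 hz
    have ht : z (Fin.last 2) = 0 := by
      by_contra h
      exact hx ⟨z, ⟨hz, lt_of_le_of_ne hz'.2.1 (Ne.symm h)⟩, rfl⟩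
    have ht2 : z 2 = 0 := ht
    rw [mem_singleton_iff]
    ext j
    fin_cases j
    · simp [ht2]
    · simp [ht2]
    · simp [ht2]
  exact measure_mono_null hsub (measure_singleton _)

/-! ### Assembly: `3 · [C K, 1] ∼ [K, 1]` -/

/-- **Cones in the Kontsevich–Zagier calculus.** For a planar representation `K` with compact
domain and integrand `1`, `3 · [C K, 1] − [K, 1] ∈ relations`: three copies of the cone over `K`
are KZ-equivalent to (the area representation of) the base. [Kontsevich–Zagier 2001, §1.2 (rules)] -/
theorem soloInformed_three_nsmul_coneRep_sub_mem_relations (K : IntegralRep 2)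
    (hKc : IsCompact K.domain) (hK1 : ∀ y ∈ K.domain, K.integrand y = 1) :
    3 • of (soloInformedConeRep K hKc) - of K ∈ relations := by
  have hNL := soloInformed_conePow_three_sub_mem_relations K hKc hK1
  have h12 : of (soloInformedConePow K hKc 3) - of (soloInformedConePow K hKc 1) -
      of (soloInformedConePow K hKc 2) ∈ relations :=
    soloInformed_conePow_add_sub_mem_relations K hKc 1 2
  have h11 : of (soloInformedConePow K hKc 2) - of (soloInformedConePow K hKc 1) -
      of (soloInformedConePow K hKc 1) ∈ relations :=
    soloInformed_conePow_add_sub_mem_relations K hKc 1 1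
  have hS := soloInformed_conePow_one_sub_srcRep_mem_relations K hKc
  have hC := soloInformed_coneSrcRep_sub_tgtRep_mem_relations K hKc
  have hA := soloInformed_coneRep_sub_tgtRep_mem_relations K hKc
  have e : 3 • of (soloInformedConeRep K hKc) - of K =
      (of (soloInformedConePow K hKc 3) - of K) -
      (of (soloInformedConePow K hKc 3) - of (soloInformedConePow K hKc 1) -
        of (soloInformedConePow K hKc 2)) -
      (of (soloInformedConePow K hKc 2) - of (soloInformedConePow K hKc 1) -
        of (soloInformedConePow K hKc 1)) -
      3 • (of (soloInformedConePow K hKc 1) - of (soloInformedConeSrcRep K hKc)) -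
      3 • (of (soloInformedConeSrcRep K hKc) - of (soloInformedConeTgtRep K hKc)) +
      3 • (of (soloInformedConeRep K hKc) - of (soloInformedConeTgtRep K hKc)) := by abel
  rw [e]
  exact relations.add_mem (relations.sub_mem (relations.sub_mem (relations.sub_mem
    (relations.sub_mem hNL h12) h11) (relations.nsmul_mem hS 3)) (relations.nsmul_mem hC 3))
    (relations.nsmul_mem hA 3)

/-- The volume of the cone: `3 · vol(C K) = area(K)`. -/
theorem soloInformed_value_coneRep (K : IntegralRep 2) (hKc : IsCompact K.domain)
    (hK1 : ∀ y ∈ K.domain, K.integrand y = 1) :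
    3 * (soloInformedConeRep K hKc).value = K.value := by
  have h := eval_eq_zero_of_mem_relations
    (soloInformed_three_nsmul_coneRep_sub_mem_relations K hKc hK1)
  simp only [map_sub, map_nsmul, eval_of, nsmul_eq_mul, Nat.cast_ofNat] at h
  linarith

/-! ### Volume rung 3 for cones -/

/-- **Volume rung `3` for cones over planar regions** (granted the Huber–Wüstholz theorem on
curve periods, through volume rung `2`): if the cones over two compact planar regions with
non-empty interior have the same volume, they are KZ-equivalent. Proof: `3·[C K] ∼ [K]`,
`3·[C K'] ∼ [K']`, equal volumes give `area(K) = area(K')`, so `[K] ∼ [K']` by volume rung `2`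
(`soloInformed_volumeRung_le_two`), and `3·x ∈ relations ⇒ x ∈ relations`
(`soloInformed_equivalent_of_nsmul_sub_mem`, the formal period ring is a `ℚ`-algebra). -/
theorem soloInformed_cone_equivalent_of_value_eq (hHW : HuberWustholzCurvePeriods)
    (K K' : IntegralRep 2) (hKc : IsCompact K.domain) (hKi : (interior K.domain).Nonempty)
    (hK1 : ∀ y ∈ K.domain, K.integrand y = 1) (hKc' : IsCompact K'.domain)
    (hKi' : (interior K'.domain).Nonempty) (hK1' : ∀ y ∈ K'.domain, K'.integrand y = 1)
    (h : (soloInformedConeRep K hKc).value = (soloInformedConeRep K' hKc').value) :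
    Equivalent (soloInformedConeRep K hKc) (soloInformedConeRep K' hKc') := by
  have h3 := soloInformed_three_nsmul_coneRep_sub_mem_relations K hKc hK1
  have h3' := soloInformed_three_nsmul_coneRep_sub_mem_relations K' hKc' hK1'
  have hv : K.value = K'.value := by
    rw [← soloInformed_value_coneRep K hKc hK1, ← soloInformed_value_coneRep K' hKc' hK1', h]
  have hE : Equivalent K K' :=
    soloInformed_volumeRung_le_two hHW le_rfl _ _ hKc hKi hKc' hKi' hK1 hK1' hv
  refine soloInformed_equivalent_of_nsmul_sub_mem (N := 3) (by norm_num) ?_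
  have e : 3 • (of (soloInformedConeRep K hKc) - of (soloInformedConeRep K' hKc')) =
      (3 • of (soloInformedConeRep K hKc) - of K) + (of K - of K') -
      (3 • of (soloInformedConeRep K' hKc') - of K') := by abel
  rw [e]
  exact relations.sub_mem (relations.add_mem h3 hE) h3'

end Summit.KontsevichZagierPeriods.KontsevichZagierPeriods.Theorems
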